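/-
Copyright: the b2b-balaban cell (near-miss cell 7), T⁴-continuum fan-out, lineage t4-ne7b-p2 (node U5c RENEWAL member).
Released under the licence of the surrounding project.
-/
import Summits.QuantumFields.BalabanUV.T4Continuum.Support.RenewalAssembly

/-!
# Non-vacuity of the renewal route's node A: every binder of `exists_relWeightBound_of_renewal` inhabited at once

Summits-side support leaf of the T⁴-continuum cell (rung (B)+1 on a FINITE torus only; NOT infinite volume, NOT the
mass gap, NOT the Clay statement; NOT a proof of the spine estimate NE7b).  Lineage `t4-ne7b-p2` (generation 22),
node U5c, RENEWAL route; the consistency ∕ non-vacuity certificate of node A of the ROUND-2 skeleton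
`t4/skeletons/NE7b-t4-ne7b-p2.md` (§5 (e)): a carrier nobody can inhabit proves nothing by being assumed.  [folklore]
decided data and real arithmetic; nothing printed is quoted or asserted; (B), BetaPertH do not occur (the toy's
`LowEnvelope`s are written down, not derived from the pin).

THE TOY RUN (the same data for both runs of the pair).  Terms `ι = Bool` (`true` = the one term with an OLD live
structure, weight `(1∕4)^K`; `false` = the structure-free term, weight `1`), live classes `κ = Bool` with `π = id`,
bad class `{true}`; one cell per age (`Cell K a = {0}`, `V = 1`, `Λ = 1`), one pending record at the slot of birth
step `0` (`Rec K 0 z = {0}`, none elsewhere), product-majorant price `ω = 2·(1∕4)^K` (`C_F = 2`, `σ = 1∕4`, `Λσ = 1∕4 < 1`);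
live family of the bad class = that one slot; dead-past factor `1` resummed to `R = 2`; live price `F = (1∕4)^K`;
envelopes `nlow = nup = 1`, `C = 1`; matching scale `j⋆ K = K∕2` (fraction `c = 1∕2`), threshold `K₀ = 2`.
§1 `relWeightBound_witness`: the END applied — `∃ K₁ ≥ 2, RelWeightBound …` with
`W = 𝟙_{K ≥ K₁}·1·renewalBudget 2 1 (1·(1∕4)) (·∕2)`.  §2 the bad class is NOT empty and carries positive weight at
every `K` (so the conclusion is not vacuous on the bad side either).

HONEST DEPENDENCY (cell): continuum YM on T⁴ ⇐ BetaPertH ∧ nine spine estimates (0/9 proved); BetaPertH ⇐ (D1) ∧ (D4)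
∧ CAP+tail.  This file changes none of it.
-/

open Finset
open Literature.MathematicalPhysics.QuantumFieldTheory.Balaban1983to89
open T4WeightBudget T4GlobalDenominator T4LiveClassFibration T4LiveStructureGas T4StabilitySocket
open Summit.QuantumFields.BalabanUV.T4Continuum.RenewalSlotGas
open Summit.QuantumFields.BalabanUV.T4Continuum.RenewalAssembly

namespace Summit.QuantumFields.BalabanUV.T4Continuum.RenewalAssemblyWitness

noncomputable section

/-! ## §1 The witness run and the END applied -/

section Witness

/-- **EVERY BINDER OF NODE A AT ONCE.**  On the toy run of the header, `exists_relWeightBound_of_renewal` applies: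
`∃ K₁ ≥ 2, RelWeightBound l₀ (fun _ => univ) A A (𝟙·badOfClass id univ {true}) (𝟙·1·renewalBudget 2 1 (1·(1∕4)) (·∕2))`
with `A K t τ = if τ then (1∕4)^K else 1`. [folklore] -/
theorem relWeightBound_witness (l₀ : ℝ) :
    ∃ K₁, 2 ≤ K₁ ∧ RelWeightBound l₀ (fun _ => (univ : Finset Bool))
      (fun K _ τ => if τ then ((1 : ℝ) / 4) ^ K else 1) (fun K _ τ => if τ then ((1 : ℝ) / 4) ^ K else 1)
      (fun K t => if K₁ ≤ K then
        badOfClass (fun _ (τ : Bool) => τ) (fun _ => (univ : Finset Bool)) (fun _ _ => ({true} : Finset Bool)) K t else ∅)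
      (Set.indicator {K | K₁ ≤ K} (fun K => 1 * renewalBudget 2 1 (1 * (1 / 4)) (fun K => K / 2) K)) := by
  -- the data
  let π : ℕ → Bool → Bool := fun _ τ => τ
  let T : ℕ → Finset Bool := fun _ => univ
  let A : ℕ → ℝ → Bool → ℝ := fun K _ τ => if τ then ((1 : ℝ) / 4) ^ K else 1
  let Bad' : ℕ → ℝ → Finset Bool := fun _ _ => {true}
  let dead : ℕ → ℝ → Bool → ℝ := fun _ _ _ => 1
  let F : ℕ → Bool → ℝ := fun K c => if c then ((1 : ℝ) / 4) ^ K else 1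
  let R : ℕ → Bool → ℝ := fun _ _ => 2
  let nlow : ℕ → ℝ → ℝ := fun _ _ => 1
  let Cell : ℕ → ℕ → Finset ℕ := fun _ _ => {0}
  let Rec : ℕ → ℕ → ℕ → Finset ℕ := fun _ j _ => if j = 0 then {0} else ∅
  let ω : ℕ → ℕ → ℕ → ℕ → ℝ := fun K _ _ _ => 2 * ((1 : ℝ) / 4) ^ K
  let str : ℕ → Bool → Finset (RSlot ℕ ℕ) := fun _ c => if c then {⟨0, 0, 0⟩} else ∅
  have hq : ∀ K : ℕ, 0 < ((1 : ℝ) / 4) ^ K := fun K => by positivity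
  -- S3: the two (identical) envelopes
  have hE : LowEnvelope l₀ T A nlow nlow 1 2 := by
    refine ⟨fun K t _ _ => ?_, fun K t _ _ => zero_le_one, fun K t _ _ => by simp [nlow]⟩
    show (1 : ℝ) ≤ ∑ τ ∈ (univ : Finset Bool), (if τ then ((1 : ℝ) / 4) ^ K else 1)
    rw [Fintype.sum_bool]; simp only [if_true, Bool.false_eq_true, if_false]
    linarith [hq K]
  -- S2: the numerator reading
  have hbs : ∀ K t, |t| ≤ l₀ → 2 ≤ K → Bad' K t ⊆ classIndex π T K := by
    intro K t _ _ c hc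
    simp only [Bad', mem_singleton] at hc
    subst hc
    exact mem_classIndex_of_mem (π := π) (T := T) (mem_univ true)
  have hup : ∀ K t, |t| ≤ l₀ → 2 ≤ K → ∀ c ∈ Bad' K t, ∀ τ ∈ fibre π T K c, A K t τ ≤ dead K t τ * F K c * nlow K t := by
    intro K t _ _ c hc τ hτ
    simp only [Bad', mem_singleton] at hc
    subst hc
    obtain ⟨-, hπ⟩ := mem_fibre.1 hτ
    simp only [π] at hπ
    subst hπ
    simp [A, dead, F, nlow]
  have hdn : ∀ K t, |t| ≤ l₀ → 2 ≤ K → ∀ c ∈ Bad' K t, ∀ τ ∈ fibre π T K c, 0 ≤ dead K t τ :=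
    fun K t _ _ c _ τ _ => zero_le_one
  have hrs : ∀ K t, |t| ≤ l₀ → 2 ≤ K → ∀ c ∈ Bad' K t, ∑ τ ∈ fibre π T K c, dead K t τ ≤ R K c := by
    intro K t _ _ c _
    calc ∑ τ ∈ fibre π T K c, dead K t τ ≤ ∑ τ ∈ (univ : Finset Bool), dead K t τ :=
          sum_le_sum_of_subset_of_nonneg (fibre_subset (π := π) (T := T) K c) fun _ _ _ => zero_le_one
      _ = 2 := by simp [dead]
      _ ≤ R K c := le_rfl
  have hFn : ∀ K t, |t| ≤ l₀ → 2 ≤ K → ∀ c ∈ Bad' K t, 0 ≤ F K c := by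
    intro K t _ _ c _; simp only [F]; split_ifs <;> positivity
  -- the budget side
  have hcell : ∀ K a, ((Cell K a).card : ℝ) ≤ 1 * (1 : ℝ) ^ a := fun K a => by simp [Cell]
  have hω0 : ∀ K, ∀ j ≤ K, ∀ z ∈ Cell K (K - j), ∀ r ∈ Rec K j z, 0 ≤ ω K j z r :=
    fun K j _ z _ r _ => by simp only [ω]; positivity
  have hslot : ∀ K, ∀ j ≤ K, ∀ z ∈ Cell K (K - j), ∑ r ∈ Rec K j z, ω K j z r ≤ 2 * ((1 : ℝ) / 4) ^ (K - j) := by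
    intro K j _ z _
    by_cases hj : j = 0
    · subst hj; simp [Rec, ω]
    · simp only [Rec, if_neg hj, sum_empty]; positivity
  have hfrac : ∀ K : ℕ, (1 / 2 : ℝ) * K ≤ ((K - K / 2 : ℕ) : ℝ) := by
    intro K
    rw [Nat.cast_sub (Nat.div_le_self K 2)]
    have h := Nat.cast_div_le (m := K) (n := 2) (α := ℝ)
    push_cast at h
    linarith
  have hinj : ∀ K t, |t| ≤ l₀ → 2 ≤ K → Set.InjOn (str K) (Bad' K t : Set Bool) := by
    intro K t _ _
    exact Set.subsingleton_of_subset_singleton (fun c hc => by simpa [Bad'] using hc) |>.injOn _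
  have hstr : ∀ K t, |t| ≤ l₀ → 2 ≤ K → ∀ c ∈ Bad' K t,
      str K c ⊆ liveSlotsR Cell Rec K ∧ ∃ o ∈ oldSlotsR Cell Rec (fun K => K / 2) K, o ∈ str K c := by
    intro K t _ hK c hc
    simp only [Bad', mem_singleton] at hc
    subst hc
    refine ⟨fun s hs => ?_, ⟨⟨0, 0, 0⟩, ?_, by simp [str]⟩⟩
    · simp only [str, if_true, mem_singleton] at hs
      subst hs
      exact mem_liveSlotsR.2 ⟨Nat.zero_le _, by simp [Cell], by simp [Rec]⟩
    · simp only [oldSlotsR, Finset.mem_sigma, Finset.mem_range]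
      exact ⟨by omega, by simp [Cell], by simp [Rec]⟩
  have hF : ∀ K t, |t| ≤ l₀ → 2 ≤ K → ∀ c ∈ Bad' K t, F K c * R K c ≤ famWeight (rslotPrice (ω K)) (str K c) := by
    intro K t _ _ c hc
    simp only [Bad', mem_singleton] at hc
    subst hc
    simp only [F, R, str, if_true, famWeight, prod_singleton, rslotPrice_mk, ω]
    linarith [hq K]
  -- the END applied
  exact exists_relWeightBound_of_renewal (dead := dead) (dead' := dead) hE hE zero_le_one hbs hup hdn hrs hFn hup hdn hrs
    hFn Cell zero_le_one one_pos hcell Rec ω hω0 (by norm_num : (0 : ℝ) ≤ 2) (by norm_num : (0 : ℝ) < 1 / 4)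
    (by norm_num) hslot (fun K => K / 2) (fun K => Nat.div_le_self K 2) (by norm_num : (0 : ℝ) < 1 / 2) hfrac str hinj
    hstr hF hF

end Witness

/-! ## §2 The bad class of the witness is not empty and is positively weighted -/

section BadClass

/-- **THE BAD SIDE IS NOT VACUOUS**: the saturated bad class of the witness run is `{true}` at every `K`, and its
weight `(1∕4)^K` is positive — so `RelWeightBound`'s `bad_left`∕`bad_right` say something at every `K ≥ K₁`. [folklore] -/
theorem witness_bad_pos (K : ℕ) (t : ℝ) :
    true ∈ badOfClass (fun _ (τ : Bool) => τ) (fun _ => (univ : Finset Bool)) (fun _ _ => ({true} : Finset Bool)) K t ∧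
      0 < ∑ τ ∈ badOfClass (fun _ (τ : Bool) => τ) (fun _ => (univ : Finset Bool)) (fun _ _ => ({true} : Finset Bool)) K t,
        (if τ then ((1 : ℝ) / 4) ^ K else 1) := by
  have hmem : true ∈ badOfClass (fun _ (τ : Bool) => τ) (fun _ => (univ : Finset Bool))
      (fun _ _ => ({true} : Finset Bool)) K t :=
    mem_badOfClass.2 ⟨mem_univ _, mem_singleton_self _⟩
  refine ⟨hmem, ?_⟩
  refine Finset.sum_pos' (fun τ _ => by split_ifs <;> positivity) ⟨true, hmem, by simp only [if_true]; positivity⟩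

/-- the witness budget at `K = 6`: `renewalBudget 2 1 (1/4) (·∕2) 6 = 2·(1/4)^4∕(3/4)·exp(2∕(3/4)) = (1∕96)·e^{8∕3}`, a
number `< 1` (`e^{8/3} < 96` since `e < 3` and `3^{8/3} < 27 < 96`) — decided up to the exponential -/
example : (2 : ℚ) * 1 * ((1 * (1 / 4)) ^ (6 - 6 / 2 + 1) / (1 - 1 * (1 / 4))) = 1 / 96 ∧
    (2 : ℚ) * 1 * (1 / (1 - 1 * (1 / 4))) = 8 / 3 := by norm_num

end BadClass

end

end Summit.QuantumFields.BalabanUV.T4Continuum.RenewalAssemblyWitness
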